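import Literature.AnabelianGeometry.EtaleTheta.BiKummerThm44HypOfGaloisCoveringZTowerAll
import Literature.AnabelianGeometry.EtaleTheta.TemperedFrobenioidOfRankOneObjectR
import HarnessLib

/-!
# [EtTh] Def. 3.6 (ii) at monoid type `Λ = ℝ` along ANY diagonal base data (higher-rank `Φ₀`): the `dm`-generic engine
# `TemperedFrobenioid.ofDiagonalBaseR`, and its instance at the ℤ-tower over `B^temp(Π^tp_X)⁰` (class (b) NV)

S. Mochizuki, *The étale theta function …*, Publ. RIMS **45** (2009) [MochizukiEtTh2009], Def. 3.6 (i)(ii) pp.76–77 (`Λ = ℝ`: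
`B₀^ℝ := ℝ·Φ₀^birat`, `F₀^ℝ := ℝ·Φ₀^cnst`, "`Φ` := the image of `Φ₀^pf`") [cite: MochizukiEtTh2009, Def 3.6 p.77]; [FrdI] Def. 1.1 (i)
p.19, Thm. 5.2 (ii) p.100.

abc-iut cell, layer L2 [EtTh], seat abc-iut-w5-d179 (gen 6); natural sequel (β) of R505/R606 (STATUS 21:2xZ).  abc-iut-L2-d2's memo
(`VNEXT-V2-RealifiedChain-L2d2.md` §2) records that the `Λ = ℝ` engines of the tree are RANK ONE (`ofRankOnePointR` w6-d048 p447026,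
`ofRankOneObjectR` L2-d2 p467678); THIS FILE is the `Λ = ℝ` twin of this seat's HIGHER-RANK engine `ofDiagonalBase` (p462730):
* `DiagonalBase.cnstFnR A ∈ B₀^ℝ(F A) = ℝ·Φ₀^birat(F A)` — the image `ι([d_A])` of the diagonal's class (`[d_A] = div₀ ϖ` is
  birational), `cnstFnR_mem_FΛ` (`∈ F₀^ℝ = B₀^ℝ ∩ ℝ·Φ₀^cnst`), `divΛ_cnstFnR` (`B₀^ℝ → (Φ₀^ℝ)^gp` is the inclusion) — VERBATIM the
  rank-one lemmas of L2-d2 / w6-d048 with `hcnst` replaced by `exists_div₀_eq`;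
* **`TemperedFrobenioid.ofDiagonalBaseR hpf P hD hD' hFSM R S : TemperedFrobenioid (ofRlfZWeak … ↦ ofRlfRWeak dm hpf) D (treeCatVocab D R S)`**
  — base `P.F`, `Φ := im(Φ₀^pf → Φ₀^rlf)` (the SAME `P.Φsub hpf`: `Φ₀^ℝ` does not depend on `Λ`), every Def. 3.6 (ii) clause PROVED:
  (a) `Φ^{bs-fld} = ι(⟨d_A⟩^pf)` monoprime (the `Λ = ℤ` computation `pfImage_inf_cnstR_eq`, `ℝ·Φ₀^cnst` being `Λ`-independent),
  (b) `Div(ι([d_A])) = ι(d_A)/1 ≠ 1`; `_isPerfect`, `isNonDilating_ofDiagonalBaseR_of_dichotomy` (the primary-ray criterion of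
  `BiKummerThm44HypOfGaloisCoveringZTowerAll`), `isFrobenioid_ofDiagonalBaseR` ([FrdI] Thm. 5.2 (ii), `hBinj` from w6-d048's
  `ofRlfRWeak_hBinj_of_reflects`);
* INSTANCE **`ZTowerTempered.temperedFrobenioidR X φ R S`** — the `Λ = ℝ` tempered Frobenioid of the ℤ-tower over the genuine base
  `B^temp(Π^tp_X)⁰`, every `X`, every character `φ`; it IS a Frobenioid; `Φ` non-dilating along every endomorphism.
Class (b): 2 defs (`DiagonalBase.cnstFnR`, `ofDiagonalBaseR`) + 1 def instance (`ZTowerTempered.temperedFrobenioidR`); no Prop fact,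
no instance, no notation, no sorry.  HONEST FRAMING: class (b) construction over interface records / the combinatorial ℤ-tower;
nothing here bears on [IUTchIII] Cor. 3.12; typed ≠ proved.
-/

noncomputable section

namespace Literature.AnabelianGeometry.EtaleTheta

open CategoryTheory Opposite Function Literature.AlgebraicGeometry.Frobenioids
  Literature.AnabelianGeometry.SemiGraphs LogDivisorModel LogDivisorModel.GaloisAction

universe u₀ v₀ u v

/-! ## §1 The constant `ι([d_A]) ∈ F₀^ℝ(F A)` -/

namespace TemperedFrobenioid.DiagonalBase

variable {D₀ : Type u₀} [Category.{v₀} D₀] {dm : DivisorMonoids.{u₀, v₀, 0} D₀}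
  (hpf : ∀ Y : D₀ᵒᵖ, IsPerfFactorialCof (dm.Φ₀.obj Y)) {D : Type u} [Category.{v} D] (P : DiagonalBase dm D)

/-- The image `ι(c) ∈ (Φ₀^ℝ)^gp(F A)` of a birational class `c = div₀ b` lies in `B₀^ℝ(F A) = ℝ·Φ₀^birat(F A)`.
[cite: MochizukiEtTh2009, Def 3.6 p.76] -/
theorem gpMap_toR_mem_realSpan_biratGp (A : D) {c : Algebra.GrothendieckGroup (dm.Φ₀.obj (op (P.F.obj A)))}
    (b : dm.B₀.obj (op (P.F.obj A))) (hbc : dm.div₀ (op (P.F.obj A)) b = c) :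
    EtaleTheta.gpMap ((RealifiedDivisorMonoids.ofRlfRWeak dm hpf).toR (op (P.F.obj A))) c ∈
      ((RealifiedDivisorMonoids.realDataWeak dm hpf).realSpan dm.biratGp).carrier (P.F.obj A) := by
  have h := (RealifiedDivisorMonoids.realDataWeak dm hpf).toRlfGp_mem_realSpan dm.biratGp (P.F.obj A) (c := c)
    (Subgroup.subset_closure ⟨b, hbc⟩)
  rw [RealifiedDivisorMonoids.toRlfGp_realDataWeak_eq] at h
  exact h

/-- **The constant `ι([d_A]) ∈ B₀^ℝ(F A)`** (`[d_A] = div₀ ϖ` is the divisor of a constant, `exists_div₀_eq`).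
[cite: MochizukiEtTh2009, Def 3.6 p.76] -/
def cnstFnR (A : Dᵒᵖ) : (RealifiedDivisorMonoids.ofRlfRWeak dm hpf).BΛ.obj (op (P.F.obj A.unop)) :=
  ⟨EtaleTheta.gpMap ((RealifiedDivisorMonoids.ofRlfRWeak dm hpf).toR (op (P.F.obj A.unop)))
      (Algebra.GrothendieckGroup.of (P.d A.unop)),
    P.gpMap_toR_mem_realSpan_biratGp hpf A.unop (P.exists_div₀_eq A.unop).choose (P.exists_div₀_eq A.unop).choose_spec.2⟩

/-- `ι([d_A]) ∈ F₀^ℝ(F A) = B₀^ℝ ∩ ℝ·Φ₀^cnst` (the function `ϖ` is constant). [cite: MochizukiEtTh2009, Def 3.6 p.76] -/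
theorem cnstFnR_mem_FΛ (A : Dᵒᵖ) : P.cnstFnR hpf A ∈ (RealifiedDivisorMonoids.ofRlfRWeak dm hpf).FΛ (op (P.F.obj A.unop)) := by
  obtain ⟨hb, hbd⟩ := (P.exists_div₀_eq A.unop).choose_spec
  have key := (RealifiedDivisorMonoids.ofRlfRWeak dm hpf).cnst_le_cnstR (op (P.F.obj A.unop)) (P.exists_div₀_eq A.unop).choose hb
  change EtaleTheta.gpMap ((RealifiedDivisorMonoids.ofRlfRWeak dm hpf).toR (op (P.F.obj A.unop)))
    (dm.div₀ (op (P.F.obj A.unop)) (P.exists_div₀_eq A.unop).choose) ∈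
      (RealifiedDivisorMonoids.ofRlfRWeak dm hpf).cnstR (op (P.F.obj A.unop)) at key
  rw [show dm.div₀ (op (P.F.obj A.unop)) (P.exists_div₀_eq A.unop).choose = Algebra.GrothendieckGroup.of (P.d A.unop) from hbd]
    at key
  exact key

/-- Its log-divisor `Div(ι([d_A]))` is `ι^gp([d_A])` (`B₀^ℝ → (Φ₀^ℝ)^gp` is the inclusion). [cite: MochizukiEtTh2009, Def 3.6 p.76] -/
theorem divΛ_cnstFnR (A : Dᵒᵖ) :
    (RealifiedDivisorMonoids.ofRlfRWeak dm hpf).divΛ (op (P.F.obj A.unop)) (P.cnstFnR hpf A) =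
      EtaleTheta.gpMap ((RealifiedDivisorMonoids.ofRlfRWeak dm hpf).toR (op (P.F.obj A.unop)))
        (Algebra.GrothendieckGroup.of (P.d A.unop)) := rfl

end TemperedFrobenioid.DiagonalBase

/-! ## §2 The `Λ = ℝ` engine along diagonal base data -/

namespace TemperedFrobenioid

variable {D₀ : Type u₀} [Category.{v₀} D₀] {dm : DivisorMonoids.{u₀, v₀, 0} D₀}
  (hpf : ∀ Y : D₀ᵒᵖ, IsPerfFactorialCof (dm.Φ₀.obj Y)) {D : Type u} [Category.{v} D] (P : DiagonalBase dm D)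
  (hD : IsConnected D) (hD' : IsTotallyEpimorphic D) (hFSM : IsOfFSMType D) (R S : (Dᵒᵖ ⥤ CommMonCat.{0}) → Prop)

include hFSM in
/-- **Def. 3.6 (ii) data of MONOID TYPE `ℝ` along diagonal base data** (`B₀^ℝ = ℝ·Φ₀^birat`, `F₀^ℝ = ℝ·Φ₀^cnst`; base `P.F`;
`Φ := im(Φ₀^pf → Φ₀^rlf)` as at `Λ = ℤ`); every clause PROVED — (a) `Φ^{bs-fld} = ι(⟨d_A⟩^pf)` monoprime, (b) `Div(ι([d_A])) = ι(d_A) ≠ 1`.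
[cite: MochizukiEtTh2009, Def 3.6 p.77] -/
def ofDiagonalBaseR : TemperedFrobenioid (RealifiedDivisorMonoids.ofRlfRWeak dm hpf) D (treeCatVocab D R S) where
  isConnected := hD
  isTotallyEpimorphic := hD'
  base := P.F
  Φ := P.Φsub hpf
  isGroupSaturated A := PfImageWeak.isGroupSaturated_mrange_toRealification (hpf (op (P.F.obj A.unop))).weak
  isPerfFactorial A := PfImageWeak.isPerfFactorialCof_mrange_toRealification (hpf (op (P.F.obj A.unop)))
  isDivisorialOn := by
    rw [treeCatVocab_isDivisorialOn]
    refine ⟨⟨fun f => isCharInjective_of_injective_of_isSharp _ (P.Φsub_pull_injective hpf f.op)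
      (PfImageWeak.isDivisorial_mrange_toRealification (hpf _)).isSharp, fun f hf => ?_⟩,
      fun A => PfImageWeak.isDivisorial_mrange_toRealification (hpf (op (P.F.obj A)))⟩
    exact (fun _ : IsIso f => PreFrobenioid.RatFrac.pull_bijective_of_isIso f) (hFSM.isIso_of_isFSM f hf)
  isMonoprime_bsFld A :=
    IsMonoprime.of_mulEquiv (MulEquiv.submonoidCongr (P.pfImage_inf_cnstR_eq hpf A).symm) (P.isMonoprime_diagImage hpf A)
  exists_FΛ_div_ne A :=
    ⟨P.cnstFnR hpf A, P.cnstFnR_mem_FΛ hpf A,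
      (hpf (op (P.F.obj A.unop))).weak.toRealification (Perfection.of _ (P.d A.unop)), ⟨_, rfl⟩, 1, one_mem _,
      P.toRealification_d_ne_one hpf A.unop, by
        simp only [map_one, div_one]
        rw [DiagonalBase.divΛ_cnstFnR]
        exact EtaleTheta.gpMap_of _ _⟩

/-- The monoid type of the engine is `ℝ`. [cite: MochizukiEtTh2009, Def 3.6 p.77] -/
theorem ofDiagonalBaseR_monoidType : (ofDiagonalBaseR hpf P hD hD' hFSM R S).monoidType = MonoidType.R := rfl

/-- `Φ(A)` of the engine is `im(Φ₀(F A)^pf → Φ₀(F A)^rlf)`. [cite: MochizukiEtTh2009, Def 3.6 p.77] -/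
@[simp] theorem ofDiagonalBaseR_Φ_carrier (A : Dᵒᵖ) :
    (ofDiagonalBaseR hpf P hD hD' hFSM R S).Φ.carrier A = P.pfImage hpf A := rfl

/-- The base functor of the engine is `P.F`. [cite: MochizukiEtTh2009, Def 3.6 p.77] -/
@[simp] theorem ofDiagonalBaseR_base : (ofDiagonalBaseR hpf P hD hD' hFSM R S).base = P.F := rfl

/-- **`Φ^{bs-fld}(A)` at `Λ = ℝ` is the diagonal image `ι(⟨d_A⟩^pf)`** (Def. 3.6 (ii)(a) with content). [cite: MochizukiEtTh2009, Def 3.6 p.77] -/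
theorem ofDiagonalBaseR_bsFld_carrier (A : Dᵒᵖ) :
    (ofDiagonalBaseR hpf P hD hD' hFSM R S).bsFld.carrier A = P.diagImage hpf A :=
  P.pfImage_inf_cnstR_eq hpf A

/-- **`Φ(A)` is perfect.** [cite: MochizukiEtTh2009, Def 4.1 p.86] -/
theorem ofDiagonalBaseR_isPerfect (A : Dᵒᵖ) : IsPerfect ((ofDiagonalBaseR hpf P hD hD' hFSM R S).Φ.carrier A) :=
  IsPerfect.of_mulEquiv (MulEquiv.ofBijective _ (PfImageWeak.mrangeRestrict_toRealification_bijective (hpf _).weak))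
    isPerfect_perfection

/-- **`Φ` is non-dilating along an endomorphism with the dichotomy «`Φ₀`-pull-back identity, or a primary carried off itself»**
([FrdI] Def. 1.1 (i); this seat's `DiagonalBase.isNonDilating_pull_of_dichotomy`). [cite: MochizukiFrdI2008, Def. 1.1 (i) p.19] -/
theorem isNonDilating_ofDiagonalBaseR_of_dichotomy (A : Dᵒᵖ) (φ : A ⟶ A)
    (h : (∀ m : dm.Φ₀.obj (op (P.F.obj A.unop)), (dm.Φ₀.map (P.F.map φ.unop).op).hom m = m) ∨
      ∃ p : dm.Φ₀.obj (op (P.F.obj A.unop)), IsPrimary p ∧ ¬ Precsim ((dm.Φ₀.map (P.F.map φ.unop).op).hom p) p) :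
    treeMonoidVocabWeak.{0}.IsNonDilating ((ofDiagonalBaseR hpf P hD hD' hFSM R S).Φ.carrier A)
      ((ofDiagonalBaseR hpf P hD hD' hFSM R S).Φ.pull φ) :=
  P.isNonDilating_pull_of_dichotomy hpf φ h

/-- **The `Λ = ℝ` engine's tempered Frobenioid IS a Frobenioid** ([FrdI] Thm. 5.2 (ii), abc-iut-L2-t3's `isFrobenioid_of_isOfFSMType`;
`hBinj` for `B₀^ℝ = ℝ·Φ₀^birat` from injective, divisibility-reflecting `Φ₀`-transitions — w6-d048's `ofRlfRWeak_hBinj_of_reflects`).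
[cite: MochizukiFrdI2008, Thm. 5.2 (ii) p.100] -/
theorem isFrobenioid_ofDiagonalBaseR (hΦinj : ∀ {Y Y' : D₀ᵒᵖ} (g : Y ⟶ Y'), Injective (dm.Φ₀.map g).hom)
    (hΦrefl : ∀ {Y Y' : D₀ᵒᵖ} (g : Y ⟶ Y') (a b : dm.Φ₀.obj Y), (dm.Φ₀.map g).hom a ∣ (dm.Φ₀.map g).hom b → a ∣ b) :
    PreFrobenioid.IsFrobenioid (ofDiagonalBaseR hpf P hD hD' hFSM R S).toElem :=
  (ofDiagonalBaseR hpf P hD hD' hFSM R S).isFrobenioid_of_isOfFSMType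
    (RealifiedDivisorMonoids.ofRlfRWeak_hBinj_of_reflects dm hpf hΦinj hΦrefl) hFSM

/-- **Non-vacuity** of the `Λ = ℝ` data along diagonal base data. [cite: MochizukiEtTh2009, Def 3.6 p.77] -/
theorem nonempty_of_diagonalBaseR (P₀ : DiagonalBase dm D) (hD₀ : IsConnected D) (hD₀' : IsTotallyEpimorphic D)
    (hFSM₀ : IsOfFSMType D) (R₀ S₀ : (Dᵒᵖ ⥤ CommMonCat.{0}) → Prop) :
    ∃ C : TemperedFrobenioid (RealifiedDivisorMonoids.ofRlfRWeak dm hpf) D (treeCatVocab D R₀ S₀), C.base = P₀.F :=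
  ⟨ofDiagonalBaseR hpf P₀ hD₀ hD₀' hFSM₀ R₀ S₀, rfl⟩

end TemperedFrobenioid

/-! ## §3 Instance: the `Λ = ℝ` tempered Frobenioid of the ℤ-tower over `B^temp(Π^tp_X)⁰` -/

namespace ZTowerTempered

variable {K : Type} [Field K] (X : SemiGraphs.TemperedArithmeticGroup.{0} K) (φ : X.Pi →* Multiplicative ℤ)
  (R S : ((ConnectedPart (BTemp X.Pi))ᵒᵖ ⥤ CommMonCat.{0}) → Prop)

/-- **The `Λ = ℝ` tempered Frobenioid of the ℤ-tower over the genuine base `B^temp(Π^tp_X)⁰`** (every `X`, every character `φ`).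
[cite: MochizukiEtTh2009, Def 3.6 p.77] -/
def temperedFrobenioidR :
    TemperedFrobenioid (RealifiedDivisorMonoids.ofRlfRWeak (dm X φ) (hpf X φ)) (ConnectedPart (BTemp X.Pi))
      (treeCatVocab (ConnectedPart (BTemp X.Pi)) R S) :=
  TemperedFrobenioid.ofDiagonalBaseR (hpf X φ) (diagonalBase X φ) QuasiTemperoid.BTempConnected.connectedPart_isConnected
    QuasiTemperoid.BTempConnected.connectedPart_isTotallyEpimorphic QuasiTemperoid.BTempConnected.connectedPart_isOfFSMType R S

/-- Its monoid type is `ℝ`. [cite: MochizukiEtTh2009, Def 3.6 p.77] -/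
theorem temperedFrobenioidR_monoidType : (temperedFrobenioidR X φ R S).monoidType = MonoidType.R := rfl

/-- Its base functor is the equivalence inverse `B^temp(Π^tp_X)⁰ ⥤ CosetCat Π^tp_X`. [cite: MochizukiEtTh2009, Def 3.6 p.77] -/
theorem temperedFrobenioidR_base : (temperedFrobenioidR X φ R S).base = (OneCompTempered.equiv X).inverse := rfl

/-- `Φ^{bs-fld}(A) = ι(⟨diag⟩^pf)` at `Λ = ℝ`. [cite: MochizukiEtTh2009, Def 3.6 p.77] -/
theorem temperedFrobenioidR_bsFld_carrier (A : (ConnectedPart (BTemp X.Pi))ᵒᵖ) :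
    (temperedFrobenioidR X φ R S).bsFld.carrier A = (diagonalBase X φ).diagImage (hpf X φ) A :=
  TemperedFrobenioid.ofDiagonalBaseR_bsFld_carrier (hpf X φ) (diagonalBase X φ) _ _ _ R S A

/-- **The `Λ = ℝ` ℤ-tower model IS a Frobenioid** ([FrdI] Thm. 5.2 (ii)). [cite: MochizukiFrdI2008, Thm. 5.2 (ii) p.100] -/
theorem isFrobenioid_temperedFrobenioidR : PreFrobenioid.IsFrobenioid (temperedFrobenioidR X φ R S).toElem :=
  TemperedFrobenioid.isFrobenioid_ofDiagonalBaseR (hpf X φ) (diagonalBase X φ) _ _ _ R S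
    (fun g => DivisorMonoids.ofGaloisActionCosetCat_Φ₀_map_injective X.isTempered _ _ g)
    fun g a b h => DivisorMonoids.ofGaloisActionCosetCat_Φ₀_map_reflects_dvd X.isTempered _ _ g a b h

/-- **`Φ` is non-dilating along every endomorphism** at `Λ = ℝ` as well (same `Φ`, same primary-ray dichotomy).
[cite: MochizukiFrdI2008, Def. 1.1 (i) p.19] -/
theorem isNonDilating_temperedFrobenioidR (A : (ConnectedPart (BTemp X.Pi))ᵒᵖ) (α : A ⟶ A) :
    treeMonoidVocabWeak.{0}.IsNonDilating ((temperedFrobenioidR X φ R S).Φ.carrier A) ((temperedFrobenioidR X φ R S).Φ.pull α) :=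
  TemperedFrobenioid.isNonDilating_ofDiagonalBaseR_of_dichotomy (hpf X φ) (diagonalBase X φ) _ _ _ R S A α
    (ZTower.phiZeroPull_dichotomy φ (isConnectedGSet_gset X A.unop) _)

end ZTowerTempered

end Literature.AnabelianGeometry.EtaleTheta

end
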